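import Mathlib
import Summits.Ventures.HodgeRepro2.T5ConductorUnramifiedPlace
import Summits.Ventures.HodgeRepro2.T5ConductorZeroCharacter
import Summits.Ventures.HodgeRepro2.T5ContinuousCharacterBall

/-!
# THE `ψ`-DUAL OF A BALL IS A BALL: `𝒪_v` IS SELF-DUAL FOR A CHARACTER OF CONDUCTOR EXPONENT `0`

Tier-5 support N3 / §G-N4.2 (seat p3, gen 84). The lattice model of the Weil representation at an unramified
place pairs a lattice with its dual under `(x, y) ↦ ψ(x y)`; for `ψ` of conductor exponent `0` the standard
lattice is its own dual. This file makes the one-dimensional statement a theorem of the tree, on p4's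
`conductorExp` (file 67 of his annex) and this seat's 325 / 327:

* **`forall_mul_le_exp_iff`** — for a field `K` with a valuation `v : K → ℤᵐ⁰` and an additive character `ψ`
  trivial on some ball and non-trivial: `ψ(x · {v ≤ exp k}) = 1 ⟺ v x ≤ exp (n(ψ) − k)` — THE DUAL OF THE BALL
  `{v ≤ exp k}` UNDER `ψ` IS THE BALL `{v ≤ exp (n(ψ) − k)}` (p4's `forall_le_exp_compAddMonoidHom_mulLeft_iff`
  and `forall_le_exp_iff_le_conductorExp`); **`setOf_forall_mul_le_exp_eq`** — the same as an equality of sets;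
* **`forall_mul_le_one_iff_of_conductorExp_eq_zero`** — `n(ψ) = 0 ⇒ {v ≤ 1}` IS SELF-DUAL:
  `ψ(x · {v ≤ 1}) = 1 ⟺ v x ≤ 1`;
* **`ramificationIdx'_eq_one_of_discr_notMem`** — for a CM field `K` and a place `v` of `K⁺` with `disc K ∉ v`,
  every `w ∣ v` of `K` has `e(w/v) = 1` (file 322's `e(w/p) = 1` through the tower `ℤ ⊆ 𝓞_{K⁺} ⊆ 𝓞_K`);
* **`forall_mul_le_one_iff_comp_trace_of_ramificationIdx'_eq_one`** — at `w ∣ v` with `e(w/v) = 1` and `ψ` on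
  `K_v` continuous, non-trivial, of conductor exponent `0`: `𝒪_w` is self-dual under `ψ ∘ Tr_{L_w/K_v}`
  (file 325's local clause (u2));
* **`forall_mul_le_one_iff_record`** — THE RECORD: `K` any CM field, `v` a place of `K⁺` with `disc K ∉ v` above
  `v_p`, `w ∣ v` of `K`, `ψ : ℚ_p → S¹` continuous non-trivial with `n(ψ) = 0`: `𝒪_w` is self-dual under
  `ψ_w := ψ ∘ Tr_{K⁺_v/ℚ_p} ∘ Tr_{K_w/K⁺_v}`; **`exists_addChar_forall_mul_le_one_iff_record`** — and such a `ψ`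
  exists (file 327).

Nothing here is a statement about (P), theta lifts or L-values. §8(d): uses an L-value-free non-vanishing
device: NO.
-/

open IsDedekindDomain IsDedekindDomain.HeightOneSpectrum NumberField
open Summit.Ventures.HodgeRepro2.T5AdditiveConductor

namespace Summit.Ventures.HodgeRepro2.T5ConductorDualBall

section General

variable {K : Type*} {M : Type*} [Field K] [Monoid M]
variable (ψ : AddChar K M) (v : Valuation K (WithZero (Multiplicative ℤ)))
variable (hb : ∃ k : ℤ, ∀ x, v x ≤ WithZero.exp k → ψ x = 1) (hne : ∃ x, ψ x ≠ 1)

include hb hne in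
/-- **THE `ψ`-DUAL OF THE BALL `{v ≤ exp k}` IS THE BALL `{v ≤ exp (n(ψ) − k)}`**: `ψ` is trivial on
`x · {v ≤ exp k}` iff `v x ≤ exp (n(ψ) − k)` (for `x ≠ 0` with `v x = exp m`: `ψ(x ·)` has conductor exponent
`n(ψ) − m`, p4's `forall_le_exp_compAddMonoidHom_mulLeft_iff`, and is trivial on `{v ≤ exp k}` iff
`k ≤ n(ψ) − m`, p4's `forall_le_exp_iff_le_conductorExp`). -/
theorem forall_mul_le_exp_iff (x : K) (k : ℤ) :
    (∀ y, v y ≤ WithZero.exp k → ψ (x * y) = 1) ↔ v x ≤ WithZero.exp (conductorExp ψ v - k) := by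
  by_cases hx : x = 0
  · subst hx
    simp [AddChar.map_zero_eq_one]
  · have hvx : v x ≠ 0 := (Valuation.ne_zero_iff v).mpr hx
    have hvx' : v x = WithZero.exp (WithZero.log (v x)) := (WithZero.exp_log hvx).symm
    have key := forall_le_exp_compAddMonoidHom_mulLeft_iff ψ v x hx (-(WithZero.log (v x)))
      (by rw [neg_neg]; exact hvx') k
    simp only [AddChar.compAddMonoidHom_apply, AddMonoidHom.coe_mulLeft] at key
    rw [key, forall_le_exp_iff_le_conductorExp ψ v hb hne, hvx', WithZero.exp_le_exp, WithZero.log_exp]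
    omega

include hb hne in
/-- The dual of the ball `{v ≤ exp k}` under `ψ`, as an equality of sets. -/
theorem setOf_forall_mul_le_exp_eq (k : ℤ) :
    {x : K | ∀ y, v y ≤ WithZero.exp k → ψ (x * y) = 1} = {x : K | v x ≤ WithZero.exp (conductorExp ψ v - k)} := by
  ext x
  exact forall_mul_le_exp_iff ψ v hb hne x k

include hb hne in
/-- **`{v ≤ 1}` IS SELF-DUAL FOR `ψ` OF CONDUCTOR EXPONENT `0`**: `ψ` is trivial on `x · {v ≤ 1}` iff `v x ≤ 1`. -/
theorem forall_mul_le_one_iff_of_conductorExp_eq_zero (h0 : conductorExp ψ v = 0) (x : K) :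
    (∀ y, v y ≤ 1 → ψ (x * y) = 1) ↔ v x ≤ 1 := by
  have := forall_mul_le_exp_iff ψ v hb hne x 0
  rw [h0, sub_zero, WithZero.exp_zero] at this
  exact this

include hb hne in
/-- The self-duality with the product written `y * x`. -/
theorem forall_mul_le_one_iff_of_conductorExp_eq_zero' (h0 : conductorExp ψ v = 0) (x : K) :
    (∀ y, v y ≤ 1 → ψ (y * x) = 1) ↔ v x ≤ 1 := by
  rw [← forall_mul_le_one_iff_of_conductorExp_eq_zero ψ v hb hne h0 x]
  simp only [mul_comm]

end General

section Continuous

variable {K : Type*} [Field K] [Valued K (WithZero (Multiplicative ℤ))]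

/-- **A continuous additive character `ψ : K → S¹` of a valued field is trivial on some ball** (p4's
`T5ContinuousCharacterBall.exists_forall_le_exp_eq_one_of_continuous`, the balls `{v ≤ exp k}` being a basis of
neighbourhoods of `0` by `Valued.mem_nhds_zero`). -/
theorem exists_forall_le_exp_of_continuous (ψ : AddChar K Circle) (hψ : Continuous ψ) :
    ∃ k : ℤ, ∀ x, Valued.v x ≤ WithZero.exp k → ψ x = 1 := by
  apply Summit.Ventures.HodgeRepro2.T5ContinuousCharacterBall.exists_forall_le_exp_eq_one_of_continuous
    Valued.v ψ hψ
  intro s hs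
  obtain ⟨γ, hγ⟩ := Valued.mem_nhds_zero.mp hs
  set t : WithZero (Multiplicative ℤ) :=
    MonoidWithZeroHom.ValueGroup₀.embedding (γ : (MonoidWithZeroHom.ofClass
      (Valued.v : Valuation K (WithZero (Multiplicative ℤ)))).ValueGroup₀) with ht
  have ht0 : t ≠ 0 := by
    intro h0
    apply γ.ne_zero
    apply MonoidWithZeroHom.ValueGroup₀.embedding_injective
    rw [← ht, h0, map_zero]
  refine ⟨WithZero.log t - 1, fun x hx => hγ ?_⟩
  show Valued.v.restrict x < (γ : (MonoidWithZeroHom.ofClass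
      (Valued.v : Valuation K (WithZero (Multiplicative ℤ)))).ValueGroup₀)
  rw [Valuation.restrict_lt_iff_lt_embedding, ← ht]
  calc Valued.v x ≤ WithZero.exp (WithZero.log t - 1) := hx
    _ < WithZero.exp (WithZero.log t) := WithZero.exp_lt_exp.mpr (by omega)
    _ = t := WithZero.exp_log ht0

end Continuous

section Unramified

variable {K L : Type*} [Field K] [NumberField K] [Field L] [NumberField L] [Algebra K L]
variable (v : HeightOneSpectrum (𝓞 K)) (w : HeightOneSpectrum (𝓞 L)) [w.asIdeal.LiesOver v.asIdeal]

/-- **`𝒪_w` IS SELF-DUAL UNDER `ψ ∘ Tr_{L_w/K_v}` AT `e(w/v) = 1`** for every continuous non-trivial `ψ` on `K_v`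
of conductor exponent `0` (file 325's local clause (u2): `n(ψ ∘ Tr) = n(ψ) = 0`). -/
theorem forall_mul_le_one_iff_comp_trace_of_ramificationIdx'_eq_one
    (he : v.asIdeal.ramificationIdx' w.asIdeal = 1)
    (ψ : AddChar (v.adicCompletion K) Circle) (hψ : Continuous ψ) (hne : ∃ y, ψ y ≠ 1)
    (h0 : conductorExp ψ (Valued.v : Valuation (v.adicCompletion K) (WithZero (Multiplicative ℤ))) = 0)
    (x : w.adicCompletion L) :
    (∀ y : w.adicCompletion L, Valued.v y ≤ 1 →
      ψ (Algebra.trace (v.adicCompletion K) (w.adicCompletion L) (x * y)) = 1) ↔ Valued.v x ≤ 1 := by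
  let ψw : AddChar (w.adicCompletion L) Circle :=
    ψ.compAddMonoidHom (Algebra.trace (v.adicCompletion K) (w.adicCompletion L)).toAddMonoidHom
  have hψw : Continuous ψw :=
    Summit.Ventures.HodgeRepro2.T5AdicCompletionConductor.continuous_comp_trace v w ψ hψ
  have hnew : ∃ y, ψw y ≠ 1 :=
    Summit.Ventures.HodgeRepro2.T5AdicCompletionConductor.exists_comp_trace_ne_one v w ψ hne
  have h0w : conductorExp ψw (Valued.v : Valuation (w.adicCompletion L) (WithZero (Multiplicative ℤ))) = 0 := by
    rw [Summit.Ventures.HodgeRepro2.T5ConductorUnramifiedPlace.conductorExp_comp_trace_eq_of_ramificationIdx'_eq_one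
      v w he ψ hψ hne, h0]
  have hb : ∃ k : ℤ, ∀ z, Valued.v z ≤ WithZero.exp k → ψw z = 1 :=
    exists_forall_le_exp_of_continuous ψw hψw
  exact forall_mul_le_one_iff_of_conductorExp_eq_zero ψw Valued.v hb hnew h0w x

end Unramified

section Record

variable (K : Type*) [Field K] [NumberField K]
variable (v : HeightOneSpectrum (𝓞 (maximalRealSubfield K))) (w : HeightOneSpectrum (𝓞 K))
  [hw : w.asIdeal.LiesOver v.asIdeal]

include hw in
/-- **`e(w/v) = 1` outside `disc K`**: for a place `v` of `K⁺` with `disc K ∉ v` and `w ∣ v` of `K`, the relative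
ramification index over `𝓞_{K⁺}` is `1` (file 322's `e(w/p) = 1` over `ℤ`; the index over `𝓞_{K⁺}` divides
it, Mathlib's `ramificationIdx_above_dvd` in the tower `ℤ ⊆ 𝓞_{K⁺} ⊆ 𝓞_K`). -/
theorem ramificationIdx'_eq_one_of_discr_notMem (h : ((discr K : ℤ) : 𝓞 (maximalRealSubfield K)) ∉ v.asIdeal) :
    v.asIdeal.ramificationIdx' w.asIdeal = 1 := by
  rw [Ideal.ramificationIdx'_eq_ramificationIdx v.asIdeal w.asIdeal v.ne_bot]
  have hdvd : w.asIdeal.ramificationIdx (𝓞 (maximalRealSubfield K)) ∣ w.asIdeal.ramificationIdx ℤ :=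
    Ideal.ramificationIdx_above_dvd (R := ℤ) v.asIdeal w.asIdeal
  rw [Summit.Ventures.HodgeRepro2.T5RecordSatakeDiscriminant.ramificationIdx_int_eq_one_of_discr_notMem' K v w h]
    at hdvd
  exact Nat.dvd_one.mp hdvd

variable (vp : HeightOneSpectrum (𝓞 ℚ)) [hv : v.asIdeal.LiesOver vp.asIdeal]

include hv hw in
/-- **THE RECORD — `𝒪_w` IS SELF-DUAL UNDER `ψ_w = ψ ∘ Tr_{K⁺_v/ℚ_p} ∘ Tr_{K_w/K⁺_v}`** at every `w ∣ v` with
`disc K ∉ v`, for every continuous non-trivial `ψ : ℚ_p → S¹` of conductor exponent `0` (files 325 and 327 at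
`v`, then the unramified step at `w`). -/
theorem forall_mul_le_one_iff_record (h : ((discr K : ℤ) : 𝓞 (maximalRealSubfield K)) ∉ v.asIdeal)
    (ψ : AddChar (vp.adicCompletion ℚ) Circle) (hψ : Continuous ψ) (hne : ∃ y, ψ y ≠ 1)
    (h0 : conductorExp ψ (Valued.v : Valuation (vp.adicCompletion ℚ) (WithZero (Multiplicative ℤ))) = 0)
    (x : w.adicCompletion K) :
    (∀ y : w.adicCompletion K, Valued.v y ≤ 1 →
      (ψ.compAddMonoidHom
        (Algebra.trace (vp.adicCompletion ℚ) (v.adicCompletion (maximalRealSubfield K))).toAddMonoidHom)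
        (Algebra.trace (v.adicCompletion (maximalRealSubfield K)) (w.adicCompletion K) (x * y)) = 1) ↔
      Valued.v x ≤ 1 := by
  let ψv : AddChar (v.adicCompletion (maximalRealSubfield K)) Circle :=
    ψ.compAddMonoidHom
      (Algebra.trace (vp.adicCompletion ℚ) (v.adicCompletion (maximalRealSubfield K))).toAddMonoidHom
  have hψv : Continuous ψv :=
    Summit.Ventures.HodgeRepro2.T5AdicCompletionConductor.continuous_comp_trace vp v ψ hψ
  have hnev : ∃ y, ψv y ≠ 1 :=
    Summit.Ventures.HodgeRepro2.T5AdicCompletionConductor.exists_comp_trace_ne_one vp v ψ hne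
  have h0v : conductorExp ψv
      (Valued.v : Valuation (v.adicCompletion (maximalRealSubfield K)) (WithZero (Multiplicative ℤ))) = 0 :=
    Summit.Ventures.HodgeRepro2.T5ConductorUnramifiedPlace.conductorExp_comp_trace_eq_zero_of_discr_notMem_cm K vp v
      h ψ hψ hne h0
  exact forall_mul_le_one_iff_comp_trace_of_ramificationIdx'_eq_one v w
    (ramificationIdx'_eq_one_of_discr_notMem K v w h) ψv hψv hnev h0v x

include hv hw in
/-- **Such a `ψ` exists** (file 327): at every `w ∣ v` with `disc K ∉ v` there is a continuous non-trivial
`ψ : ℚ_p → S¹` of conductor exponent `0` for which `𝒪_w` is self-dual under `ψ_w`. -/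
theorem exists_addChar_forall_mul_le_one_iff_record
    (h : ((discr K : ℤ) : 𝓞 (maximalRealSubfield K)) ∉ v.asIdeal) :
    ∃ ψ : AddChar (vp.adicCompletion ℚ) Circle, Continuous ψ ∧ (∃ y, ψ y ≠ 1) ∧
      conductorExp ψ (Valued.v : Valuation (vp.adicCompletion ℚ) (WithZero (Multiplicative ℤ))) = 0 ∧
      ∀ x : w.adicCompletion K,
        (∀ y : w.adicCompletion K, Valued.v y ≤ 1 →
          (ψ.compAddMonoidHom
            (Algebra.trace (vp.adicCompletion ℚ) (v.adicCompletion (maximalRealSubfield K))).toAddMonoidHom)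
            (Algebra.trace (v.adicCompletion (maximalRealSubfield K)) (w.adicCompletion K) (x * y)) = 1) ↔
          Valued.v x ≤ 1 := by
  obtain ⟨ψ, hψ, hne, h0⟩ :=
    Summit.Ventures.HodgeRepro2.T5ConductorZeroCharacter.exists_continuous_addChar_conductorExp_eq_zero_adicCompletion
      (K := ℚ) vp
  exact ⟨ψ, hψ, hne, h0, fun x => forall_mul_le_one_iff_record K v w vp h ψ hψ hne h0 x⟩

end Record

end Summit.Ventures.HodgeRepro2.T5ConductorDualBall
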